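import Mathlib
import HarnessLib
import HarnessLib.Audit
import Summits.CriticalPhenomena.Statement

/-!
Route: PrimaryAtInfinity

DORMANT since 2026-09-03T15:14:22Z (reconciler: no traction for 5 d (last activity statement-checked at 2026-08-29T14:32:59Z); parked, not closed — `ledger route dormant route-CriticalPhenomena-PrimaryAtInfinity --off` to reactivate) — unstaffed, not closed; items shared with open routes are served there. `ledger route dormant <id> --off` reactivates.

# Route PrimaryAtInfinity — sigma is a primary at infinity — first far-field multipole (dipole =
K(monopole)) plus Lebowitz clustering and eta > 0 give Moebius covariance on Z^3

It suffices to show X = (M1) ∧ (FC) ∧ (2PT) ∧ (E) together with the shared non-Gaussianity item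
0636, realising card
primary-at-infinity-dipole-monopole ("σ is a primary at infinity"). (M1) FirstMultipoleIdentity: for
the normalised pointwise scaling
limit S of the critical Ising correlators on ℤ³ with two-point function c‖a−b‖^(−2Δ), every
S_(n+1)(x, y) has a first-order far-field
expansion ‖y‖^(−2Δ)[A₀(x) + ŷ·A₁(x)/‖y‖ + o(1/‖y‖)] locally uniformly in x, and DIPOLE =
𝒦̃(MONOPOLE): A₁·b = [2Δ Σᵢ b·xᵢ − Σᵢ K_b(xᵢ)·∇ᵢ]A₀
weakly on non-coincident configurations, K_b(x) = ‖x‖²b − 2(b·x)x (the |y|^(−2Δ) coefficient of the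
special-conformal Ward identity as
one spin recedes). (FC) FarFieldClustering: as a further point z recedes, ‖z‖(A₀(x,z) − c S_n(x)) →
0 and A₁(x,z) − 2Δc S_n(x) z → 0
locally uniformly (monopole clustering with rate o(1/‖z‖), dipole clustering). (2PT)
TwoPointPowerLawEta: the limit two-point function
is an isotropic pure power c‖a−b‖^(−2Δ) with 2Δ > 1 (η > 0). (E) ExistsRegularLimit: a normalised,
translation- and parity-invariant,
non-degenerate pointwise scaling limit, continuous off the diagonals, exists (no rotation or scale
clause: those are OUTPUT). Two support
lemmas of pure analysis close the chain: MultipoleToWard ((M1)+(FC) ⇒ the weak special-conformal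
Ward identity for every S_n) and
WardToMoebius (translations + parity + SCT Ward identities + continuity ⇒ IsMoebiusCovariant Δ S,
since P_μ and K_μ generate so(4,1)).
Lean: `FirstMultipoleIdentity ∧ FarFieldClustering ∧ TwoPointPowerLawEta ∧ ExistsRegularLimit ∧
IsingEuclidUpgradeR4NonGaussian` (the decls of this route file, written out in full under Cruxes;
each elaborates in the planner's Sketch.lean, rc 0, together with a sorry-free `assembly_holds`)

## Assembly
Pure logic plus `linarith` (sorry-free `assembly_holds` in the planner's Sketch.lean): take (ρ, S)
from ExistsRegularLimit; TwoPointPowerLawEta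
gives c > 0, Δ > 1/2 and the two-point law; for each n, FirstMultipoleIdentity at level n+1 gives
(A₀, A₁) with the far-field expansion and
the identity, and FarFieldClustering at level n gives their monopole/dipole clustering;
MultipoleToWard turns these into the weak SCT Ward
identity for every S n; WardToMoebius (with normalisation, continuity, translation and parity
invariance from ExistsRegularLimit) gives
IsMoebiusCovariant Δ S; item 0636 gives HasNontrivialU4 S; 0 < Δ from Δ > 1/2; conclude
CritIsing3DConformalLimit with the witness (ρ, Δ, S).

Rationale: WHY THIS LINE. Möbius covariance of all S_n is equivalent, order by order at infinity, to Taylor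
regularity of the inverted family, and its FIRST order
says that a spin sent to infinity is remembered only through a monopole A₀ and a dipole A₁ tied by
the special-conformal generator
(K_μ = ι P_μ ι; FrancescoMathieuSenechal1997 §4.1 (4.14)–(4.19), §4.2.1 (4.31)–(4.32)); the route
bets that this first order is ENOUGH:
inserting one more far point z and peeling it off by clustering turns (M1) at level n+2 into the
full Ward identity for S_n up to
remainders of size ‖z‖·O(‖z‖^(−2Δ)) = O(‖z‖^(−η)) (computation checked by the planner: the
O(‖y‖^(1−2Δ)) terms cancel identically, the
n = 1 instance is an identity), so the Lebowitz–Glimm–Jaffe pair-truncation tree bound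
(GlimmJaffe1987 Cor. 4.3.3, Lebowitz1974,
Newman1975Gaussian; in tree lebowitz_holds is its |X| = 2 case) plus η > 0 supply the monopole rate,
and translations + K-flows generate
Möb⁰(3) with parity giving the other component (FrancescoMathieuSenechal1997 (4.19)–(4.21);
LuscherMack1975 for infinitesimal ⇒ global).
Imported areas: CFT Ward-identity formalism read at infinity (mathematical physics), classical
correlation inequalities (probability),
Lie-group generation and weak-to-strong integration of first-order PDE (analysis). The threshold "η
> 0 kills the marginal vector
channel" is the same as in DelamotteTissierWschebor2016 (arXiv:1501.01776 §5–6: Lebowitz ⇒ D_V ≥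
d−1+η in a Wilsonian effective-action
argument, non-rigorous); what this line does that DTW and the tree's bare upgrade items (1982
InversionUpgradeNormalised, 1344/2599
MoebiusLimit, 0637 refuted as typed) do not: it states the upgrade as typed properties of the
lattice limit's correlation FUNCTIONS —
one falsifiable physics crux (M1) about the first multipole, one clustering crux (FC) with an
inequality route, and two provable analysis
lemmas — and it needs neither a stress tensor, nor OS reconstruction, nor rotation or scale
covariance as input (both come OUT of [K,P]).

RANKED CRUXES. #2 FirstMultipoleIdentity (crux) — (M1)/(P3) of the card, "dipole = 𝒦̃(monopole)":
for every pointwise scaling limit S of criticalCorr 3 (ρ > 0 on (0,1]) that is normalised (S = 0 off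
NonCoincident) and has two-point function S 2 (a,b) = c‖a−b‖^(−2Δ) (c > 0), and every n, there are
far-field coefficients A₀ : (ℝ³)ⁿ → ℝ, A₁ : (ℝ³)ⁿ → ℝ³ with ‖y‖^(2Δ+1) S_(n+1)(x,y) − ‖y‖A₀(x) −
A₁(x)·ŷ → 0 as ‖y‖ → ∞ locally uniformly on NonCoincident, and for every b ∈ ℝ³ and every smooth
compactly supported test function φ on NonCoincident: ∫ (A₁·b) φ = ∫ A₀ [(2Δ−6)(Σᵢ b·xᵢ) φ +
Dφ(x)[(‖xᵢ‖²b − 2(b·xᵢ)xᵢ)ᵢ]] (the weak form of A₁·b = [2ΔΣ b·xᵢ − Σ K_b(xᵢ)·∇ᵢ]A₀; trivially true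
for even n, where S_(n+1) ≡ 0; an identity for n = 1). [difficulty: open-problem] (why it might
fail: It is the ‖y‖^(−2Δ) coefficient of the special-conformal Ward identity: false iff the ℤ³ limit
is scale- but not Möbius-covariant (a dimension-2 virial current; excluded only by DTW2016's
non-rigorous RG argument and MC Δ_V>5); it also presupposes convergent far-field (OPE-at-∞)
asymptotics.) [FrancescoMathieuSenechal1997, DelamotteTissierWschebor2016, arXiv:1501.01776,
Nakayama2015, MenesesEtAl2019, ElshowkNakayamaRychkov2011, PolandRychkovVichi2019,
Literature.Barriers.CriticalPhenomena.ScaleCovarianceNotMoebius]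
#3 FarFieldClustering (crux) — (FC), the clustering of the first far-field multipole as a second
point recedes: for every normalised pointwise scaling limit S of criticalCorr 3 with S 2 (a,b) =
c‖a−b‖^(−2Δ), every n and every pair (A₀, A₁) of far-field coefficients of S_(n+2) (in the sense of
item FirstMultipoleIdentity at level n+1): ‖z‖·(A₀(x,z) − c·S_n(x)) → 0 (MONOPOLE clustering with
rate o(1/‖z‖): the truncated function's monopole is O(‖z‖^(−2Δ)) by the Lebowitz–Glimm–Jaffe
pair-truncation tree bound, and 2Δ > 1) and A₁(x,z) − 2Δc·S_n(x)·z → 0 (DIPOLE clustering: the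
dipole moment at infinity of X∪{z} is asymptotically that of a charge c·S_n(x) at z; natural size
‖z‖^(1−2Δ) = ‖z‖^(−η)), both as ‖z‖ → ∞ locally uniformly in x ∈ NonCoincident. [deps:
FirstMultipoleIdentity, TwoPointPowerLawEta] [difficulty: XL] (why it might fail: Given rank 2 and
the monopole clause, the dipole clause is equivalent to the Ward identity, so it carries rank 2's
risk; its inequality proof needs a scale-natural bound on the SECOND-order far-field remainder that
no printed correlation inequality gives, and the rates need 2Δ>1 (η>0).) [GlimmJaffe1987,
Lebowitz1974, Newman1975Gaussian, DelamotteTissierWschebor2016, KellySherman1968,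
Literature.Probability.LatticeModels.lebowitz_holds, Literature.Probability.LatticeModels.gks_two,
PolandRychkovVichi2019]
#4 TwoPointPowerLawEta (crux) — (2PT) = card (P2) (item 0634 + strict η > 0, continuum form): every
non-degenerate pointwise scaling limit S of criticalCorr 3 (ρ > 0 on (0,1]) has two-point function S
2 (a,b) = c‖a−b‖^(−2Δ) for some c > 0 and Δ > 1/2 — isotropy, pure power law and η = 2Δ−1 > 0 at the
two-point level. Rigorously Δ ∈ [1/2,1] for any scale-covariant non-degenerate limit
(scalingDimension_mem_Icc_holds) and η ≤ 1/2 if it exists (DuminilcopinPanis2025 Thm 1.5); the route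
needs the strict inequality (its rates are ‖z‖^(1−2Δ)). [difficulty: open-problem] (why it might
fail: Bundles three open inputs: existence of η on ℤ³ (only 0≤η≤1/2 IF it exists), two-point
isotropy (postulated, ICM2022 §8.1), and η>0 strictly (η≈0.036; all rigorous bounds allow G≍‖x‖⁻¹,
i.e. Δ=1/2, where the route's rate ‖z‖^(1−2Δ) does not decay).) [DuminilCopinICM2022,
DuminilcopinPanis2025, PolandRychkovVichi2019, arXiv:2012.11672,
Literature.Probability.LatticeModels.criticalTwoPoint_bounds_holds,
Literature.Probability.LatticeModels.scalingDimension_mem_Icc_holds]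
#5 ExistsRegularLimit (crux) — (E) = card (E_tr): there exist ρ > 0 on (0,1] and S : CorrFamily 3
with HasPointwiseScalingLimit (criticalCorr 3) ρ S, S = 0 off NonCoincident (normalisation, the
typing fix of IsingEuclidUpgradeRefutations), IsNondegenerateTwoPoint S, IsTranslationInvariant S,
parity S n (−x) = S n x, and every S n continuous on NonCoincident 3 n. Deliberately NO rotation
invariance and NO scale covariance (both are output of [K,P] on this route); strictly weaker in
spirit than CritIsing3DEuclideanLimit (0638) and than ExistsScaleCovariantLimit (1981), plus the
soft regularity the analysis lemmas consume. [difficulty: open-problem] (why it might fail: Full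
δ→0⁺ convergence for all n is open on ℤ³ (only subsequential limits from c‖x‖⁻²≤G≤C‖x‖⁻¹, no
uniqueness mechanism in d=3); continuity off diagonals and exact translation/parity invariance of
the limit need n-point lattice regularity beyond Messager–Miracle-Solé.) [DuminilCopinICM2022,
AizenmanDuminilCopinSidoravicius2015, MessagerMiracleSoleJSP1977,
Literature.Probability.LatticeModels.criticalTwoPoint_bounds_holds,
Literature.Probability.LatticeModels.messager_miracleSole_holds,
Literature.Barriers.CriticalPhenomena.RigorousRGSmallParameter]
#6 IsingEuclidUpgradeR4NonGaussian (crux) — shared item 0636 verbatim (card (P5), lowest rank,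
imported complement): every non-degenerate pointwise scaling limit S of the renormalised critical
Ising correlators on ℤ³ has connected four-point function U₄ ≢ 0 on non-coincident configurations
(random-current intersection handle; owned by IsingEuclidUpgrade / IsingCFTData / HyperoctahedralRP
/ AnomalousForcesInteraction / PerfectScreening lines). [difficulty: open-problem] (why it might
fail: No proof that U₄≢0 in d=3: the double-current intersection probability at macroscopic
separation must stay >0 as δ→0; RP long-range models ON ℤ³ (α<3/2) are Gaussian
(LongRangeTrivialityOnZ3); in d=4 P_∞≡0 and the n=3 identity is empty.)
[AizenmanDuminilCopinAnnals2021, DuminilCopinICM2022,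
Literature.Probability.LatticeModels.ursellFour_eq_doubleCurrent,
Literature.Barriers.CriticalPhenomena.IsingTrivialityFromDimensionFour,
Literature.Barriers.CriticalPhenomena.LongRangeTrivialityOnZ3]
#9 MultipoleToWard (support) — (P1) of the card, the converse lemma, algebra half (pure analysis on
CorrFamily 3, provable): if every S n is continuous on NonCoincident, c ≠ 0, and for every n there
are far-field coefficients (A₀, A₁) of S_(n+2) satisfying the first-multipole identity at level n+1
and the monopole/dipole clustering of item FarFieldClustering at level n, then every S n satisfies
the weak special-conformal Ward identity with weight Δ: ∫ S_n [(2Δ−6)(Σᵢ b·xᵢ)φ + Dφ(x)[(K_b(xᵢ))ᵢ]]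
= 0 for all b and all smooth φ compactly supported in NonCoincident. Proof (planner-checked): test
the level-(n+1) identity with φ(x)χ_L(z), χ_L(z) = L⁻³χ(z/L); the explicit terms cS_n(x)·2Δ(b·z)
cancel (∫𝒦̃†χ_L = 2Δ∫(b·z)χ_L), leaving c(∫χ_L)∫S_n 𝒦̃†φ = ∫∫(R₁·b)φχ_L − ∫∫R 𝒦̃†(φχ_L) = o(1) +
O(L)·o(1/L). [difficulty: provable-now] [FrancescoMathieuSenechal1997, HormanderALPDO1]
#9 WardToMoebius (support) — (P1) of the card, group half (pure analysis, provable): a normalised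
family S : CorrFamily 3, continuous on NonCoincident, translation invariant, parity invariant (S n
(−x) = S n x) and satisfying the weak special-conformal Ward identities with weight Δ for every n,
is IsMoebiusCovariant Δ S. Route of proof: [K_b, P_a] = 2(a·b)(Σ xᵢ·∇ᵢ + nΔ) − 2M_ab gives the
dilation (weight Δ) and rotation Ward identities on the P/K-invariant test space; weak first-order
identities with smooth coefficients integrate along the flows (test against φ∘Φ_(−t)) and continuity
upgrades a.e. to everywhere; translations and SCTs generate Möb⁰(3) ≅ SO⁺(4,1) (so(4,1) from P, K,
D, L), and the unit inversion is (ι∘(−I))∘(−I) with ι∘(−I) orientation preserving, so parity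
supplies the second component; values off NonCoincident are 0 on both sides. [difficulty: L]
[FrancescoMathieuSenechal1997, LuscherMack1975, HormanderALPDO1]

TWO-LAYER PLAN. FarFieldClustering ⇐ MonopoleClusteringRate → DipoleClustering → FarFieldClustering,
with MonopoleClusteringRate ⇐ (a Literature cite fact:
the Glimm–Jaffe Cor. 4.3.3 pair-truncation tree bound 0 ≤ ⟨σ_Xσ_zσ_y⟩ − ⟨σ_X⟩⟨σ_zσ_y⟩ ≤ Σ_(Y⊆X
odd)[⟨σ_Yσ_z⟩⟨σ_(X∖Y)σ_y⟩ + ⟨σ_Yσ_y⟩⟨σ_(X∖Y)σ_z⟩]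
for criticalCorr 3, passed to the limit) + TwoPointPowerLawEta (provable then), and DipoleClustering
⇐ positivity (GKS II) + monopole
bound + a scale-natural SECOND-order far-field remainder |E(y)| ≤ C‖z‖^(2−2Δ)‖y‖⁻² for ‖y‖ ≥ 2‖z‖
(the bet: optimising ‖y‖ ≍ ‖z‖ gives
|R₁| ≲ ‖z‖^(1−2Δ)). ExistsRegularLimit ⇐ ExistsLimit (∃ ρ S, non-degenerate pointwise limit) →
LimitRegularity (normalised version is
translation/parity invariant and continuous off diagonals; MMS + ADC-type regularity) →
ExistsRegularLimit. FirstMultipoleIdentity may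
later be split by level: n = 3 (weight-free form Q = −𝒦⁰_b P_∞ for the merging probability P =
−U₄/(2 S₂S₂), ADC identity
ursellFour_eq_doubleCurrent) as the first informative child, all n as the second. WardToMoebius ⇐
CommutatorWard (D and L identities
from [K,P]) → FlowIntegration → WardToMoebius if a prover asks.

KILL CRITERIA. A refutation of FirstMultipoleIdentity for the Ising limit (e.g. a proof that a
normalised limit with the two-point law violates the n = 3
identity, or that the limit carries a conserved dimension-2 virial current) closes the route (close
--reason refuted:FirstMultipoleIdentity)
and is direct evidence against clause (ii) of the conjunct itself — file ¬(ii) then. A proof of η(3)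
= 0 in power form (G ≍ ‖x‖⁻¹, Δ = 1/2)
refutes TwoPointPowerLawEta and kills the inequality engine of FarFieldClustering (rates ‖z‖^(1−2Δ)
do not decay): pivot to a Δ_ε > 1
(OPE-rate) clustering input or close. Refutation of MultipoleToWard or WardToMoebius AS TYPED (junk
values, test-function class, flow
through ∞) forces a restate, not a pivot — the mathematics is classical. ExistsRegularLimit refuted
⇒ the conjunct is false (existence is
part of it). MoebiusLimit (item 1344) or InversionUpgradeNormalised (1982) + LimitRotationInvariant
(1980) proved elsewhere moot ranks 2–3
(route superseded; the lemmas keep independent interest as the first-multipole criterion).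

NOT DECOMPOSED YET. The lattice-to-limit passage of the Glimm–Jaffe Cor. 4.3.3 bound for the plus
state at β_c on ℤ³ (finite volume, free/+ b.c., h = 0 →
plusExpect; a cite fact to be requested, its |X| = 2 case is lebowitz_holds); the second-order
far-field remainder statement (child of
FarFieldClustering); continuity/translation/parity of the limit from lattice regularity (children of
ExistsRegularLimit); the n = 3
special case of FirstMultipoleIdentity and its random-current reading (P_∞, Q as one-ended limits of
sourced double currents — the card's
(L2)–(L3), of independent interest, need definitions not in tree); the pieces of WardToMoebius
(commutator identities on the test space,
flow integration with configurations passing through ∞ on a codimension-3 set, generation of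
SO⁺(4,1)); the sphere-field linear-response
reading (L2) (needs uniformSphereResponse / dipoleSphereResponse definitions) — none of these are
items now (D-0019: ≤ two layers).

CHEAPEST FALSIFIER. (i) Pencil, run by the planner: the barrier witness
ScaleNotMoebius.witnessFamily (Δ = 1/2, S₄ = Σ_pairs ‖·‖⁻²) — it must violate a
hypothesis, and it does: S₄(x₁,x₂,x₃,y) ↛ 0 as ‖y‖ → ∞ (no far-field expansion, no clustering),
consistent with the barrier's scope caveat;
a generalized free field with any Δ satisfies (M1)+(FC) and IS Möbius (excluded for Ising only by
0636) — consistent; the family S₄ = Wick +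
g(Σ_(i<j)‖xᵢ−xⱼ‖²)^(−2Δ), S₆ = Wick (Δ > 1/2) satisfies every first-multipole identity but is not
Möbius — and violates the MONOPOLE clause of
(FC) (its S₆ does not cluster onto its S₄), showing both cruxes are load-bearing. (ii) The cheapest
real test, not run (no kit in plancard
mode): worm-algorithm Monte Carlo of the n = 3 identity at β_c on 96³ — merging probability P[x₁y ↔
x₂x₃] for ‖y‖ = R, 2R, 4R along ±e₁,
±(e₁+e₂)/√2, fit the 1/‖y‖ directional coefficient Q and compare with −𝒦⁰_b P_∞ from finite
differences of the extrapolated P_∞ (signed O(1)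
prediction, no free parameter). (iii) Lookup done: is "first multipole at infinity for all n ⇒
conformal" in print? Not found (searches
under Novelty); the forward direction is textbook (FrancescoMathieuSenechal1997 §4.2–4.3).

NUMBERS. Δ_σ = 0.5181489(10), η = 0.0362978(20), Δ_ε = 1.412625(10) (conformal bootstrap,
PolandRychkovVichi2019 Table II); MC bound on the lowest
virial-current candidate Δ_V > 5.0 (MenesesEtAl2019 §1). Rigorous: c‖x‖⁻² ≤ ⟨σ₀σ_x⟩_(β_c(3)) ≤
C‖x‖⁻¹ (criticalTwoPoint_bounds_holds), hence
Δ ∈ [1/2,1] for scale-covariant non-degenerate limits (scalingDimension_mem_Icc_holds); η ≤ 1/2 if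
it exists (DuminilcopinPanis2025 Thm 1.5).
Rates on this route: monopole remainder ≤ O(‖z‖^(−2Δ)) = O(‖z‖^(−1.036)) by Glimm–Jaffe Cor. 4.3.3
(CFT expectation O(‖z‖^(−Δ_ε)) =
O(‖z‖^(−1.41))); dipole remainder natural size ‖z‖^(1−2Δ) = ‖z‖^(−0.036) by the inequality route
(CFT expectation ‖z‖^(1−Δ_ε) = ‖z‖^(−0.41)):
mathematically decaying, numerically invisible — numerics must target the n = 3 IDENTITY (O(1)
quantities), not the rates. DTW's bound
D_V ≥ d − 1 + η = 2.036 vs the virial value 2 is the same gap η. Items at open: 8 (5 cruxes incl.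
shared 0636, 2 support, 1 assembly).

DEFINITION REQUESTS. (1) notion HasFarFieldExpansion (S : CorrFamily d) (Δ : ℝ) (n : ℕ) (A₀ : ((Fin
n → ℝ^d) → ℝ)) (A₁ : ((Fin n → ℝ^d) → ℝ^d)) : Prop —
the locally uniform first-order far-field (multipole-at-infinity) expansion used verbatim in ranks
2, 3 and MultipoleToWard
(topic Literature/Probability/LatticeModels, next to ConformalCovariance); (2) notion sctWardWeak (S
: CorrFamily d) (Δ : ℝ) (n : ℕ) : Prop —
the weak special-conformal Ward identity with weight Δ on NonCoincident d n (test functions C^∞_c),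
with its adjoint operator
(2Δ − 2d)(Σ b·xᵢ)φ + Dφ[(‖xᵢ‖²b − 2(b·xᵢ)xᵢ)ᵢ]; both would shorten every statement here and serve
cards one-scalar-one-plane-three-moments /
current-connection-invariance. (3) cite fact wanted (family crit-ising): "pair-truncation tree
bound" = GlimmJaffe1987 Cor. 4.3.3 (Lebowitz
inequalities, Cor. 4.3.2; Lebowitz1974) for isingCorr with free/+ b.c., h = 0, β ≥ 0, |A|,|B| even:
0 ≤ ⟨σ_Aσ_B⟩ − ⟨σ_A⟩⟨σ_B⟩ ≤ Σ over
partitions A = A₁⊔A₂, B = B₁⊔B₂ with |A₁|,|B₁| odd of ⟨σ_(A₁)σ_(B₁)⟩⟨σ_(A₂)σ_(B₂)⟩ (the tree has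
only the |A| = |B| = 2 case, `lebowitz`).
Filed after open with `ledger workitem add --kind definition/cite … --for <FarFieldClustering id>`.

Novelty: Searches (2026-08-15): `lit read arxiv:1501.01776 --grep Lebowitz|virial|eta` (DTW2016 §5–6, pp. 8,
11–12 read: Lebowitz ⇒ ⟨φ^mφ^n⟩_c ≤ CG²
⇒ D_V ≥ d−1+η ⇒ "scale ⇒ conformal for Ising, all d ≤ 4", non-rigorous Wilsonian RG); `lit search
--hybrid "special conformal Ward identity
asymptotic expansion point at infinity multipole primary criterion"` (15 docs, textbooks only:
FrancescoMathieuSenechal1997 pp. 97–105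
re-read — (4.14)–(4.21) generators/so(d+1,1), (4.31)–(4.32) quasi-primary, (4.51)–(4.54) SCT
constraint); `lit search --hybrid "Lebowitz
inequalities duplicated spins q t"` (8 books; GlimmJaffe1987 §4.3 read: Cor. 4.3.2 Lebowitz, Cor.
4.3.3 pair-truncation tree bound —
the printed form of the card's hypothesis (b)); `lit search --source crossref "scale invariance
conformal invariance Ising"` (15: DTW2016
doi:10.1103/physreve.93.012144, Nakayama2015, DePolsiTissierWschebor2019
doi:10.1007/s10955-019-02411-3, Balog et al. 2020,
Cabrera–De Polsi–Wschebor 2025); `lit search --source zbmath` (3, irrelevant); `lit galaxy search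
"scale invariance implies conformal
invariance" --star all` (10 rows: general QFT texts — Makeenko, Altland–Simons, Gatto 1973; nothing
on a first-multipole criterion);
`lit galaxy search "special conformal Ward identity point at infinity" --star all` (0); `lit
frontier CriticalPhenomena --since 2020` (30
rows, none on scale⇒conformal for lattice limits); openalex/arxiv legs rate-limited (429, logged);
the tree (5 Theses files, 105 cards,
negatives in  [refs: 10.1103/physreve.93.012144, 10.1007/s10955-019-02411-3, 1501.01776, arxiv:1501.01776, doi:10.1103/physreve.93.012144, doi:10.1007/s10955-019-02411-3, FrancescoMathieuSenechal1997, GlimmJaffe1987, Nakayama2015, Lebowitz1974, DelamotteTissierWschebor2016]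

Barriers (technique_class: multipole-at-infinity, gaussian-inequalities, group-gen): - technique_class: multipole-at-infinity, gaussian-inequalities, group-gen
- Literature.Barriers.CriticalPhenomena.ScaleCovarianceNotMoebius: squarely relevant and evaded by
MODEL INPUT, not by upgrading Euclidean data: the hypotheses used (HasPointwiseScalingLimit
(criticalCorr 3), the far-field expansion, the first-multipole identity, clustering inherited from
Lebowitz–Glimm–Jaffe inequalities) are exactly those the barrier's scope caveat (a) exempts; its
witness (Δ = 1/2, S₄ = Σ_pairs ‖·‖⁻²) is not clustering (S₄ ↛ 0 as one point recedes) so it fails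
the far-field hypothesis of ranks 2–3 outright, and it sits at η = 0 where the route's rates
‖z‖^(1−2Δ) do not decay — the strict η > 0 of rank 4 is not cosmetic. All ∀-statements over limits
carry the normalisation S = 0 off NonCoincident (lesson of IsingEuclidUpgradeRefutations /
not_euclideanScaleUpgrade).
- Literature.Barriers.CriticalPhenomena.LiouvilleRigidity: respected — only the Möbius group of ℝ³ ∪
{∞} appears, generated from translations and K-flows (so(4,1)); no planar conformal maps, no
discrete holomorphicity.
- Literature.Barriers.CriticalPhenomena.BootstrapLatticeBlindness: evaded — (M1) and (FC) are
properties of the LATTICE limit tied to criticalCorr 3 through HasPointwiseScalingLimit and lattice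
inequalities, not consistency conditions on an abstract CFT data set; the n = 3 form is a lattice
observable (double-current merging probability).
- Literature.Barriers.CriticalPhenomena.IsingTrivialityFromDimensionF

Novelty grade: new-combination — refuter route-review grade (2026-08-15; search basis = planner's documented hybrid/galaxy/crossref queries + my re-derivations; remote legs down in this session). Joins (a) the textbook special-conformal Ward identity read order-by-order at infinity (DMS §4.2–4.3; Lüscher–Mack infinitesimal⇒global)  (refuter refuter-rreview-route-CriticalPhenomena--c23efa21-0, 2026-08-15T14:02:07Z; prior: DelamotteTissierWschebor2016 (arXiv:1501.01776) §5–6; FrancescoMathieuSenechal1997 §4.1–4.3; GlimmJaffe1987 Cor. 4.3.3; Lebowitz1974; LuscherMack1975; Nakayama2015; doi:10.1007/s10955-019-02411-3 (DePolsiTissierWschebor2019))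

History (route lifecycle, newest last):
- 2026-08-24T06:31:54Z · DORMANT — reconciler: no traction for 6.6 d (last activity item-evidence-added at 2026-08-17T16:05:46Z); parked, not closed — `ledger route dormant route-CriticalPhenomen (operator:999:3717333)
- 2026-08-27T15:35:45Z · REACTIVATED — reconciler: reactivated — activity statement-checked at 2026-08-27T13:50:46Z after parking at 2026-08-24T06:31:54Z (operator:999:3087138)
- 2026-09-03T15:14:22Z · DORMANT — reconciler: no traction for 5 d (last activity statement-checked at 2026-08-29T14:32:59Z); parked, not closed — `ledger route dormant route-CriticalPhenomena-Pr (operator:999:448637)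

sub-problem: Ising3DConformalLimit · status: dormant · opened planner-plancard-CriticalPhenomena-Ising3DCon-709de9a3-0 2026-08-15T11:40:52Z · rev 2 · ledger route-CriticalPhenomena-PrimaryAtInfinity
GENERATED by the gate from the ledger (D-0016/17). Provers cite these decls: `theorem foo : Summit.CriticalPhenomena.Ising3DConformalLimit.Theses.PrimaryAtInfinity.<Decl> := …` in Summits/CriticalPhenomena/Ising3DConformalLimit/Theorems/<Name>.lean.
-/

namespace Summit.CriticalPhenomena.Ising3DConformalLimit.Theses.PrimaryAtInfinity

open scoped BigOperators Topology Manifold Classical MeasureTheory ProbabilityTheory Matrix InnerProductSpace ComplexConjugate ContinuousMap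
open Filter Set Function TopologicalSpace MeasureTheory

attribute [summit_statement] _root_.Ising3DConformalLimit

/-- item stmt-CriticalPhenomena-5352 · crux · rank 2 · open · by planner
why it might fail: It IS the ‖y‖^(−2Δ) order of the special-conformal Ward identity: false iff the ℤ³ limit is scale- but not Möbius-covariant (a Δ=2 virial current, excluded only by DTW2016's non-rigorous RG argument and MC Δ_V>5); it also presupposes an o(‖y‖^(−2Δ−1)) far-field expansion, unproved for odd n+1≥4.
sources: DelamotteTissierWschebor2016, arXiv:1501.01776, MenesesEtAl2019, Nakayama2015, ElshowkNakayamaRychkov2011, FrancescoMathieuSenechal1997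
[crux] (M1)/(P3) of the card, "dipole = 𝒦̃(monopole)": for every pointwise scaling limit S of
criticalCorr 3 (ρ > 0 on (0,1]) that is normalised (S = 0 off NonCoincident) and has two-point
function S 2 (a,b) = c‖a−b‖^(−2Δ) (c > 0), and every n, there are far-field coefficients A₀ : (ℝ³)ⁿ
→ ℝ, A₁ : (ℝ³)ⁿ → ℝ³ with ‖y‖^(2Δ+1) S_(n+1)(x,y) − ‖y‖A₀(x) − A₁(x)·ŷ → 0 as ‖y‖ → ∞ locally
uniformly on NonCoincident, and for every b ∈ ℝ³ and every smooth compactly supported test function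
φ on NonCoincident: ∫ (A₁·b) φ = ∫ A₀ [(2Δ−6)(Σᵢ b·xᵢ) φ + Dφ(x)[(‖xᵢ‖²b − 2(b·xᵢ)xᵢ)ᵢ]] (the weak
form of A₁·b = [2ΔΣ b·xᵢ − Σ K_b(xᵢ)·∇ᵢ]A₀; trivially true for even n, where S_(n+1) ≡ 0; an
identity for n = 1). [difficulty: open-problem] -/
@[route_item "route-CriticalPhenomena-PrimaryAtInfinity"]
def FirstMultipoleIdentity : Prop :=
  ∀ (ρ : ℝ → ℝ) (S : Literature.Probability.LatticeModels.CorrFamily 3) (c Δ : ℝ), (∀ δ ∈ Set.Ioc (0:ℝ) 1, 0 < ρ δ) → Literature.Probability.LatticeModels.HasPointwiseScalingLimit (Literature.Probability.LatticeModels.criticalCorr 3) ρ S → (∀ n z, z ∉ Literature.Probability.LatticeModels.NonCoincident 3 n → S n z = 0) → 0 < c → (∀ a b : EuclideanSpace ℝ (Fin 3), a ≠ b → S 2 ![a, b] = c * ‖a - b‖ ^ (-(2 * Δ))) → ∀ n : ℕ, ∃ (A₀ : (Fin n → EuclideanSpace ℝ (Fin 3)) → ℝ) (A₁ : (Fin n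 → EuclideanSpace ℝ (Fin 3)) → EuclideanSpace ℝ (Fin 3)), TendstoLocallyUniformlyOn (fun (y : EuclideanSpace ℝ (Fin 3)) (x : Fin n → EuclideanSpace ℝ (Fin 3)) => ‖y‖ ^ (2 * Δ + 1) * S (n + 1) (Fin.snoc x y) - ‖y‖ * A₀ x - inner ℝ (A₁ x) (‖y‖⁻¹ • y)) 0 (Filter.cocompact (EuclideanSpace ℝ (Fin 3))) (Literature.Probability.LatticeModels.NonCoincident 3 n) ∧ ∀ (b : EuclideanSpace ℝ (Fin 3)) (φ : (Fin n → EuclideanSpace ℝ (Fin 3)) → ℝ), ContDiff ℝ ((⊤ : ℕ∞) : WithTop ℕ∞) φ → HasCompactSupport φ → tsupport φ ⊆ Literature.Probability.LatticeModels.NonCoincident 3 n → ∫ x, inner ℝ (A₁ x) b * φ x = ∫ x, A₀ x * ((2 * Δ - 6) * (∑ i, inner ℝ b (x i)) * φ x + fderiv ℝ φ x (fun i => ‖x i‖ ^ 2 • b - (2 * inner ℝ b (x i)) • x i))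

/-- item stmt-CriticalPhenomena-5353 · crux · rank 3 · open · by planner
why it might fail: Given rank 2 and its monopole clause, the dipole clause is equivalent to the full Ward identity, so it carries rank 2's risk; the only inequality engine (Glimm–Jaffe Cor. 4.3.3 tree bound) leaves a dipole remainder of size ‖z‖^(1−2Δ)=‖z‖^(−η): needs strict η>0 and an unprinted 2nd-order bound.
sources: GlimmJaffe1987, Lebowitz1974, Newman1975Gaussian, KellySherman1968, DelamotteTissierWschebor2016, Literature.Probability.LatticeModels.lebowitz_holds
[crux] (FC), the clustering of the first far-field multipole as a second point recedes: for every
normalised pointwise scaling limit S of criticalCorr 3 with S 2 (a,b) = c‖a−b‖^(−2Δ), every n and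
every pair (A₀, A₁) of far-field coefficients of S_(n+2) (in the sense of item
FirstMultipoleIdentity at level n+1): ‖z‖·(A₀(x,z) − c·S_n(x)) → 0 (MONOPOLE clustering with rate
o(1/‖z‖): the truncated function's monopole is O(‖z‖^(−2Δ)) by the Lebowitz–Glimm–Jaffe
pair-truncation tree bound, and 2Δ > 1) and A₁(x,z) − 2Δc·S_n(x)·z → 0 (DIPOLE clustering: the
dipole moment at infinity of X∪{z} is asymptotically that of a charge c·S_n(x) at z; natural size
‖z‖^(1−2Δ) = ‖z‖^(−η)), both as ‖z‖ → ∞ locally uniformly in x ∈ NonCoincident. [deps: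
FirstMultipoleIdentity, TwoPointPowerLawEta] [difficulty: XL] -/
@[route_item "route-CriticalPhenomena-PrimaryAtInfinity"]
def FarFieldClustering : Prop :=
  ∀ (ρ : ℝ → ℝ) (S : Literature.Probability.LatticeModels.CorrFamily 3) (c Δ : ℝ), (∀ δ ∈ Set.Ioc (0:ℝ) 1, 0 < ρ δ) → Literature.Probability.LatticeModels.HasPointwiseScalingLimit (Literature.Probability.LatticeModels.criticalCorr 3) ρ S → (∀ n z, z ∉ Literature.Probability.LatticeModels.NonCoincident 3 n → S n z = 0) → 0 < c → (∀ a b : EuclideanSpace ℝ (Fin 3), a ≠ b → S 2 ![a, b] = c * ‖a - b‖ ^ (-(2 * Δ))) → ∀ (n : ℕ) (A₀ : (Fin (n + 1) → EuclideanSpace ℝ (Fin 3)) → ℝ) (A₁ : (Fin (n + 1) → EuclideanSpace ℝ (Fin 3)) → EuclideanSpace ℝ (Fin 3)), TendstoLocallyUniformlyOn (fun (y : EuclideanSpace ℝ (Fin 3)) (w : Fin (n + 1) → EuclideanSpace ℝ (Fin 3)) => ‖y‖ ^ (2 * Δ + 1) * S (n + 2) (Fin.snoc w y) - ‖y‖ *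 A₀ w - inner ℝ (A₁ w) (‖y‖⁻¹ • y)) 0 (Filter.cocompact (EuclideanSpace ℝ (Fin 3))) (Literature.Probability.LatticeModels.NonCoincident 3 (n + 1)) → TendstoLocallyUniformlyOn (fun (z : EuclideanSpace ℝ (Fin 3)) (x : Fin n → EuclideanSpace ℝ (Fin 3)) => ‖z‖ * (A₀ (Fin.snoc x z) - c * S n x)) 0 (Filter.cocompact (EuclideanSpace ℝ (Fin 3))) (Literature.Probability.LatticeModels.NonCoincident 3 n) ∧ TendstoLocallyUniformlyOn (fun (z : EuclideanSpace ℝ (Fin 3)) (x : Fin n → EuclideanSpace ℝ (Fin 3)) => A₁ (Fin.snoc x z) - (2 * Δ * c * S n x) • z) 0 (Filter.cocompact (EuclideanSpace ℝ (Fin 3))) (Literature.Probability.LatticeModels.NonCoincident 3 n)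

/-- item stmt-CriticalPhenomena-5354 · crux · rank 4 · open · by planner
why it might fail: Bundles three open inputs: existence of η on ℤ³ (rigorously only c‖x‖⁻²≤G≤C‖x‖⁻¹; η≤1/2 IF it exists, DuminilcopinPanis2025 Thm 1.5), isotropy of the limit (proved only in 2D, arXiv:2012.11672), and STRICT η>0 (η≈0.036): Δ=1/2, where the route's rates do not decay, is allowed by all rigorous bounds.
sources: DuminilcopinPanis2025, DuminilCopinICM2022, arXiv:2012.11672, PolandRychkovVichi2019, Literature.Probability.LatticeModels.criticalTwoPoint_bounds_holds, Literature.Probability.LatticeModels.scalingDimension_mem_Icc_holds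
[crux] (2PT) = card (P2) (item 0634 + strict η > 0, continuum form): every non-degenerate pointwise
scaling limit S of criticalCorr 3 (ρ > 0 on (0,1]) has two-point function S 2 (a,b) = c‖a−b‖^(−2Δ)
for some c > 0 and Δ > 1/2 — isotropy, pure power law and η = 2Δ−1 > 0 at the two-point level.
Rigorously Δ ∈ [1/2,1] for any scale-covariant non-degenerate limit (scalingDimension_mem_Icc_holds)
and η ≤ 1/2 if it exists (DuminilcopinPanis2025 Thm 1.5); the route needs the strict inequality (its
rates are ‖z‖^(1−2Δ)). [difficulty: open-problem] -/
@[route_item "route-CriticalPhenomena-PrimaryAtInfinity"]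
def TwoPointPowerLawEta : Prop :=
  ∀ (ρ : ℝ → ℝ) (S : Literature.Probability.LatticeModels.CorrFamily 3), (∀ δ ∈ Set.Ioc (0:ℝ) 1, 0 < ρ δ) → Literature.Probability.LatticeModels.HasPointwiseScalingLimit (Literature.Probability.LatticeModels.criticalCorr 3) ρ S → Literature.Probability.LatticeModels.IsNondegenerateTwoPoint S → ∃ c Δ : ℝ, 0 < c ∧ 1 / 2 < Δ ∧ ∀ a b : EuclideanSpace ℝ (Fin 3), a ≠ b → S 2 ![a, b] = c * ‖a - b‖ ^ (-(2 * Δ))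

/-- item stmt-CriticalPhenomena-5355 · crux · rank 5 · open · by planner
why it might fail: Existence of the full δ→0⁺ limit for all n on ℤ³ is open (DuminilCopinICM2022 §8.4): two-point bounds give only subsequential limits, and d=3 has no uniqueness mechanism (no small parameter: RigorousRGSmallParameter); continuity off diagonals, translation/parity need n-point regularity beyond MMS.
sources: DuminilCopinICM2022, AizenmanDuminilCopinSidoravicius2015, MessagerMiracleSoleJSP1977, Literature.Probability.LatticeModels.criticalTwoPoint_bounds_holds, Literature.Probability.LatticeModels.messager_miracleSole_holds, Literature.Barriers.CriticalPhenomena.RigorousRGSmallParameter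
[crux] (E) = card (E_tr): there exist ρ > 0 on (0,1] and S : CorrFamily 3 with
HasPointwiseScalingLimit (criticalCorr 3) ρ S, S = 0 off NonCoincident (normalisation, the typing
fix of IsingEuclidUpgradeRefutations), IsNondegenerateTwoPoint S, IsTranslationInvariant S, parity S
n (−x) = S n x, and every S n continuous on NonCoincident 3 n. Deliberately NO rotation invariance
and NO scale covariance (both are output of [K,P] on this route); strictly weaker in spirit than
CritIsing3DEuclideanLimit (0638) and than ExistsScaleCovariantLimit (1981), plus the soft regularity
the analysis lemmas consume. [difficulty: open-problem] -/
@[route_item "route-CriticalPhenomena-PrimaryAtInfinity"]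
def ExistsRegularLimit : Prop :=
  ∃ (ρ : ℝ → ℝ) (S : Literature.Probability.LatticeModels.CorrFamily 3), (∀ δ ∈ Set.Ioc (0:ℝ) 1, 0 < ρ δ) ∧ Literature.Probability.LatticeModels.HasPointwiseScalingLimit (Literature.Probability.LatticeModels.criticalCorr 3) ρ S ∧ (∀ n z, z ∉ Literature.Probability.LatticeModels.NonCoincident 3 n → S n z = 0) ∧ Literature.Probability.LatticeModels.IsNondegenerateTwoPoint S ∧ Literature.Probability.LatticeModels.IsTranslationInvariant S ∧ (∀ n (x : Fin n → EuclideanSpace ℝ (Fin 3)), S n (fun i => -(x i)) = S n x) ∧ (∀ n, ContinuousOn (S n) (Literature.Probability.LatticeModels.NonCoincident 3 n))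

/-- item stmt-CriticalPhenomena-0636 · crux · rank 6 · open · by planner
why it might fail: U₄≢0 in d=3 is open: by Aizenman's identity it needs the double-current intersection probability at macroscopic separation to stay >0 as δ→0 — false in d≥4 (ADC2021), unproved in d=3; RP long-range models ON ℤ³ with α<3/2 are Gaussian (LongRangeTrivialityOnZ3): d=3 alone does not force it.
sources: Aizenman1982, AizenmanDuminilCopinAnnals2021, DuminilCopinICM2022, Literature.Probability.LatticeModels.ursellFour_eq_doubleCurrent, Literature.Barriers.CriticalPhenomena.IsingTrivialityFromDimensionFour, Literature.Barriers.CriticalPhenomena.LongRangeTrivialityOnZ3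
Crux r4 (non-triviality in d=3): every non-degenerate pointwise scaling limit S of the renormalised
critical Ising correlators on Z^3 has connected four-point function U4 ≢ 0 on non-coincident
configurations. Intended tool: the random-current identity U4(x,y,z,t) =
−2⟨σxσy⟩⟨σzσt⟩·P^{xy,zt}[C_{n1+n2}(x) ∩ C_{n1+n2}(z) ≠ ∅] (Aizenman 1982; ADC2021 arXiv:1912.07973
eq. (3.11)): non-Gaussianity ⇔ the intersection probability of the two double-current clusters at
macroscopic separation does not vanish as δ → 0. Contrast: for d ≥ 4 every such limit IS Gaussian
(Literature.Probability.LatticeModels.highDim_triviality). Its negation refutes the conjunct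
Ising3DConformalLimit itself. -/
@[route_item "route-CriticalPhenomena-PrimaryAtInfinity"]
def IsingEuclidUpgradeR4NonGaussian : Prop :=
  ∀ (ρ : ℝ → ℝ) (S : Literature.Probability.LatticeModels.CorrFamily 3), (∀ δ ∈ Set.Ioc (0:ℝ) 1, 0 < ρ δ) → Literature.Probability.LatticeModels.HasPointwiseScalingLimit (Literature.Probability.LatticeModels.criticalCorr 3) ρ S → Literature.Probability.LatticeModels.IsNondegenerateTwoPoint S → Literature.Probability.LatticeModels.HasNontrivialU4 S

/-- item stmt-CriticalPhenomena-5356 · support · rank 9 · closed · proved by Summit.CriticalPhenomena.Ising3DConformalLimit.Theorems.multipoleToWard_proof @ b4aad75eafd0 (prover) · by planner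
sources: FrancescoMathieuSenechal1997, HormanderALPDO1
[support] (P1) of the card, the converse lemma, algebra half (pure analysis on CorrFamily 3,
provable): if every S n is continuous on NonCoincident, c ≠ 0, and for every n there are far-field
coefficients (A₀, A₁) of S_(n+2) satisfying the first-multipole identity at level n+1 and the
monopole/dipole clustering of item FarFieldClustering at level n, then every S n satisfies the weak
special-conformal Ward identity with weight Δ: ∫ S_n [(2Δ−6)(Σᵢ b·xᵢ)φ + Dφ(x)[(K_b(xᵢ))ᵢ]] = 0 for
all b and all smooth φ compactly supported in NonCoincident. Proof (planner-checked): test the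
level-(n+1) identity with φ(x)χ_L(z), χ_L(z) = L⁻³χ(z/L); the explicit terms cS_n(x)·2Δ(b·z) cancel
(∫𝒦̃†χ_L = 2Δ∫(b·z)χ_L), leaving c(∫χ_L)∫S_n 𝒦̃†φ = ∫∫(R₁·b)φχ_L − ∫∫R 𝒦̃†(φχ_L) = o(1) +
O(L)·o(1/L). [difficulty: provable-now] -/
@[route_item "route-CriticalPhenomena-PrimaryAtInfinity"]
def MultipoleToWard : Prop :=
  ∀ (S : Literature.Probability.LatticeModels.CorrFamily 3) (c Δ : ℝ), c ≠ 0 → (∀ n, ContinuousOn (S n) (Literature.Probability.LatticeModels.NonCoincident 3 n)) → (∀ n : ℕ, ∃ (A₀ : (Fin (n + 1) → EuclideanSpace ℝ (Fin 3)) → ℝ) (A₁ : (Fin (n + 1) → EuclideanSpace ℝ (Fin 3)) → EuclideanSpace ℝ (Fin 3)), TendstoLocallyUniformlyOn (fun (y : EuclideanSpace ℝ (Fin 3)) (w : Fin (n + 1) → EuclideanSpace ℝ (Fin 3)) => ‖y‖ ^ (2 * Δ + 1) * S (n + 2) (Fin.snoc w y) - ‖y‖ * A₀ w - inner ℝ (A₁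 w) (‖y‖⁻¹ • y)) 0 (Filter.cocompact (EuclideanSpace ℝ (Fin 3))) (Literature.Probability.LatticeModels.NonCoincident 3 (n + 1)) ∧ (∀ (b : EuclideanSpace ℝ (Fin 3)) (ψ : (Fin (n + 1) → EuclideanSpace ℝ (Fin 3)) → ℝ), ContDiff ℝ ((⊤ : ℕ∞) : WithTop ℕ∞) ψ → HasCompactSupport ψ → tsupport ψ ⊆ Literature.Probability.LatticeModels.NonCoincident 3 (n + 1) → ∫ w, inner ℝ (A₁ w) b * ψ w = ∫ w, A₀ w * ((2 * Δ - 6) * (∑ i, inner ℝ b (w i)) * ψ w + fderiv ℝ ψ w (fun i => ‖w i‖ ^ 2 • b - (2 * inner ℝ b (w i)) • w i))) ∧ TendstoLocallyUniformlyOn (fun (z : EuclideanSpace ℝ (Fin 3)) (x : Fin n → EuclideanSpace ℝ (Fin 3)) => ‖z‖ * (A₀ (Fin.snoc x z) - c * S n x)) 0 (Filter.cocompact (EuclideanSpace ℝ (Fin 3))) (Literature.Probability.LatticeModels.NonCoincident 3 n) ∧ TendstoLocallyUniformlyOn (fun (z : EuclideanSpace ℝ (Fin 3)) (x : Fin n →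 EuclideanSpace ℝ (Fin 3)) => A₁ (Fin.snoc x z) - (2 * Δ * c * S n x) • z) 0 (Filter.cocompact (EuclideanSpace ℝ (Fin 3))) (Literature.Probability.LatticeModels.NonCoincident 3 n)) → ∀ (n : ℕ) (b : EuclideanSpace ℝ (Fin 3)) (φ : (Fin n → EuclideanSpace ℝ (Fin 3)) → ℝ), ContDiff ℝ ((⊤ : ℕ∞) : WithTop ℕ∞) φ → HasCompactSupport φ → tsupport φ ⊆ Literature.Probability.LatticeModels.NonCoincident 3 n → ∫ x, S n x * ((2 * Δ - 6) * (∑ i, inner ℝ b (x i)) * φ x + fderiv ℝ φ x (fun i => ‖x i‖ ^ 2 • b - (2 * inner ℝ b (x i)) • x i)) = 0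

-- `MultipoleToWard` holds: proved by `Summit.CriticalPhenomena.Ising3DConformalLimit.Theorems.multipoleToWard_proof` @ b4aad75eafd0 (its module imports this route file, so no `_holds` link can be stated here).

/-- item stmt-CriticalPhenomena-5357 · support · rank 9 · closed · proved by Summit.CriticalPhenomena.Ising3DConformalLimit.PrecisionLaplacianMoebiusLimitOfTwoPointLaw.wardToMoebius @ 2edb6c98a81a (prover) · by planner
sources: FrancescoMathieuSenechal1997, LuscherMack1975, HormanderALPDO1
[support] (P1) of the card, group half (pure analysis, provable): a normalised family S : CorrFamily
3, continuous on NonCoincident, translation invariant, parity invariant (S n (−x) = S n x) and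
satisfying the weak special-conformal Ward identities with weight Δ for every n, is
IsMoebiusCovariant Δ S. Route of proof: [K_b, P_a] = 2(a·b)(Σ xᵢ·∇ᵢ + nΔ) − 2M_ab gives the dilation
(weight Δ) and rotation Ward identities on the P/K-invariant test space; weak first-order identities
with smooth coefficients integrate along the flows (test against φ∘Φ_(−t)) and continuity upgrades
a.e. to everywhere; translations and SCTs generate Möb⁰(3) ≅ SO⁺(4,1) (so(4,1) from P, K, D, L), and
the unit inversion is (ι∘(−I))∘(−I) with ι∘(−I) orientation preserving, so parity supplies the
second component; values off NonCoincident are 0 on both sides. [difficulty: L] -/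
@[route_item "route-CriticalPhenomena-PrimaryAtInfinity"]
def WardToMoebius : Prop :=
  ∀ (S : Literature.Probability.LatticeModels.CorrFamily 3) (Δ : ℝ), (∀ n z, z ∉ Literature.Probability.LatticeModels.NonCoincident 3 n → S n z = 0) → (∀ n, ContinuousOn (S n) (Literature.Probability.LatticeModels.NonCoincident 3 n)) → Literature.Probability.LatticeModels.IsTranslationInvariant S → (∀ n (x : Fin n → EuclideanSpace ℝ (Fin 3)), S n (fun i => -(x i)) = S n x) → (∀ (n : ℕ) (b : EuclideanSpace ℝ (Fin 3)) (φ : (Fin n → EuclideanSpace ℝ (Fin 3)) → ℝ), ContDiff ℝ ((⊤ : ℕ∞) : WithTop ℕ∞) φ → HasCompactSupport φ → tsupport φ ⊆ Literature.Probability.LatticeModels.NonCoincident 3 n → ∫ x, S n x * ((2 * Δ - 6) * (∑ i, inner ℝ b (x i)) * φ x + fderiv ℝ φ x (fun i => ‖x i‖ ^ 2 • b - (2 * inner ℝ b (x i)) • x i)) = 0) → Literature.Probability.LatticeModels.IsMoebiusCovariant Δ S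

-- `WardToMoebius` holds: proved by `Summit.CriticalPhenomena.Ising3DConformalLimit.PrecisionLaplacianMoebiusLimitOfTwoPointLaw.wardToMoebius` @ 2edb6c98a81a (its module imports this route file, so no `_holds` link can be stated here).

/-- item stmt-CriticalPhenomena-5358 · assembly · rank 1 · closed · proved by Summit.CriticalPhenomena.Ising3DConformalLimit.Theorems.primaryAtInfinity_assembly_proof @ 292fe237f9c7 (prover) · by planner
sources: FrancescoMathieuSenechal1997, DuminilCopinICM2022, GlimmJaffe1987
[assembly] FirstMultipoleIdentity → FarFieldClustering → TwoPointPowerLawEta → ExistsRegularLimit →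
MultipoleToWard → WardToMoebius → IsingEuclidUpgradeR4NonGaussian → Ising3DConformalLimit (root
abbrev of the sub-problem statement =
Literature.Probability.LatticeModels.CritIsing3DConformalLimit). -/
@[route_item "route-CriticalPhenomena-PrimaryAtInfinity"]
def Assembly : Prop :=
  FirstMultipoleIdentity → FarFieldClustering → TwoPointPowerLawEta → ExistsRegularLimit → MultipoleToWard → WardToMoebius → IsingEuclidUpgradeR4NonGaussian → Ising3DConformalLimit

-- `Assembly` holds: proved by `Summit.CriticalPhenomena.Ising3DConformalLimit.Theorems.primaryAtInfinity_assembly_proof` @ 292fe237f9c7 (its module imports this route file, so no `_holds` link can be stated here).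

/-! D-0027 §2.1 — DECIDING THEOREM (planner-authored via `route open/edit --closes-file`; by planner-rbadge-CriticalPhenomena-PrimaryAtInfi-9cf0c974-g4-0 2026-08-15T16:10:28Z):
its hypotheses are this route's items and its conclusion the sub-problem Statement (glue_lint), and it elaborates with this file. -/

@[closes "route-CriticalPhenomena-PrimaryAtInfinity"] theorem closes (h₁ : FirstMultipoleIdentity) (h₂ : FarFieldClustering) (h₃ : TwoPointPowerLawEta)
    (h₄ : ExistsRegularLimit) (h₅ : MultipoleToWard) (h₆ : WardToMoebius)
    (h₇ : IsingEuclidUpgradeR4NonGaussian) : _root_.Ising3DConformalLimit := by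
  obtain ⟨ρ, S, hρ, hlim, hnorm, hnd, htrans, hpar, hcont⟩ := h₄
  obtain ⟨c, Δ, hc, hΔ, h2pt⟩ := h₃ ρ S hρ hlim hnd
  have hward := h₅ S c Δ hc.ne' hcont (fun n => by
    obtain ⟨A₀, A₁, hexp, hid⟩ := h₁ ρ S c Δ hρ hlim hnorm hc h2pt (n + 1)
    obtain ⟨hmono, hdip⟩ := h₂ ρ S c Δ hρ hlim hnorm hc h2pt n A₀ A₁ hexp
    exact ⟨A₀, A₁, hexp, hid, hmono, hdip⟩)
  have hΔpos : (0 : ℝ) < Δ := by linarith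
  exact ⟨ρ, Δ, S, hρ, hΔpos, hlim, hnd, h₆ S Δ hnorm hcont htrans hpar hward, h₇ ρ S hρ hlim hnd⟩

end Summit.CriticalPhenomena.Ising3DConformalLimit.Theses.PrimaryAtInfinity
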